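import Mathlib
import Literature.Probability.LatticeModels.LatticeLaplacianZd
import HarnessLib

/-!
# Crux `PositiveSolutionAsymptotics` (stmt-CriticalPhenomena-4496), stub T4: chains in a lattice annulus

THEOREM-ONLY file (no definitions, no named facts), `--supports stmt-CriticalPhenomena-4496`.

`stub_annulusChain` is stub T4 of the (reshaped) birth skeleton of crux
`Summit.CriticalPhenomena.Ising3DConformalLimit.Theses.InverseSquareTelemetry.PositiveSolutionAsymptotics`.
It is pure geometry of `ℤ³ ⊂ ℝ³`: for every step ratio `θ > 0` there are `N` (depending on `θ`
only) and `r₀` such that for `r ≥ r₀` any two lattice points `x, y` of the spherical shell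
`{r/2 ≤ |·|₂ ≤ r}` are joined by a chain `z 0 = x, z 1, …, z N = y` of lattice points of the fat
annulus `{r/4 ≤ |·|₂ ≤ 2r}` with consecutive Euclidean steps `≤ θ r` (repetitions allowed).  The
lead runs an elliptic Harnack chain along it.

Proof.  Three straight segments `x → a → b → y` through the lattice axis points
`a = (±⌈r/2⌉, 0, 0)`, `b = (0, ±⌈r/2⌉, 0)` (signs chosen so that `⟨x,a⟩ ≥ 0`, `⟨b,y⟩ ≥ 0`;
`⟨a,b⟩ = 0`).  Along a segment `c(t) = (1-t)p + tq` with `⟨p,q⟩ ≥ 0` and `|p|,|q| ∈ [r/2, r]`,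
`|c(t)|² = (1-t)²|p|² + t²|q|² + 2t(1-t)⟨p,q⟩ ∈ [r²/8, r²]`.  Each segment is sampled at
`t = j/K`, `K = ⌈4/θ⌉₊`, and rounded coordinatewise to the nearest lattice point
(`|u - round u| ≤ 1/2`): the rounded points have `|·|₂² ∈ [r²/16, 4r²]` once `r ≥ 9`, and
consecutive rounded points differ by at most `√(8r²/K² + 6) ≤ θ r` once `r ≥ 4/θ`.  The three
`K`-step chains are concatenated (`N = K + K + K`, `r₀ = 9 + 4/θ`).  Everything is elementary real
arithmetic (`nlinarith`) on the three coordinates. [folklore]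
-/

namespace Summit.CriticalPhenomena.Ising3DConformalLimit.Theorems.PositiveSolutionAsymptotics

open Literature.Probability.LatticeModels Finset

/-- **Concatenation of two finite chains.** If `z₁ 0, …, z₁ N₁` and `z₂ 0, …, z₂ N₂` are chains
(all points satisfy `P`, consecutive points satisfy `S`) with `z₁ N₁ = z₂ 0`, then
`j ↦ if j ≤ N₁ then z₁ j else z₂ (j - N₁)` is a chain of length `N₁ + N₂` from `z₁ 0` to `z₂ N₂`.
[folklore] -/
theorem annulusChain_append {α : Type*} (P : α → Prop) (S : α → α → Prop) (z₁ z₂ : ℕ → α)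
    (N₁ N₂ : ℕ) (h : z₁ N₁ = z₂ 0) (hP₁ : ∀ j ≤ N₁, P (z₁ j)) (hP₂ : ∀ j ≤ N₂, P (z₂ j))
    (hS₁ : ∀ j < N₁, S (z₁ j) (z₁ (j + 1))) (hS₂ : ∀ j < N₂, S (z₂ j) (z₂ (j + 1))) :
    ∃ z : ℕ → α, z 0 = z₁ 0 ∧ z (N₁ + N₂) = z₂ N₂ ∧ (∀ j ≤ N₁ + N₂, P (z j)) ∧
      (∀ j < N₁ + N₂, S (z j) (z (j + 1))) := by
  refine ⟨fun j => if j ≤ N₁ then z₁ j else z₂ (j - N₁), by simp, ?_, ?_, ?_⟩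
  · dsimp only
    by_cases hN₂ : N₂ = 0
    · subst hN₂
      rw [if_pos (by omega), Nat.add_zero, h]
    · rw [if_neg (by omega), Nat.add_sub_cancel_left]
  · intro j hj
    dsimp only
    by_cases hj₁ : j ≤ N₁
    · rw [if_pos hj₁]
      exact hP₁ j hj₁
    · rw [if_neg hj₁]
      exact hP₂ _ (by omega)
  · intro j hj
    dsimp only
    by_cases hj₁ : j + 1 ≤ N₁
    · rw [if_pos hj₁, if_pos (by omega)]
      exact hS₁ j (by omega)
    · by_cases hj₂ : j ≤ N₁
      · have hjeq : j = N₁ := by omega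
        subst hjeq
        rw [if_pos le_rfl, if_neg hj₁, Nat.add_sub_cancel_left, h]
        exact hS₂ 0 (by omega)
      · rw [if_neg hj₁, if_neg hj₂, show j + 1 - N₁ = (j - N₁) + 1 by omega]
        exact hS₂ _ (by omega)

/-- **Rounding one coordinate.** With `w = round u` (`|u - w| ≤ 1/2`):
`w² ≤ (3/2)u² + 3/4` and `(2/3)u² - 1/2 ≤ w²` (from `2uw' ≤ u²/2 + 2w'²`). [folklore] -/
theorem annulusChain_round_sq_bounds (u : ℝ) :
    ((round u : ℤ) : ℝ) ^ 2 ≤ 3 / 2 * u ^ 2 + 3 / 4 ∧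
      2 / 3 * u ^ 2 - 1 / 2 ≤ ((round u : ℤ) : ℝ) ^ 2 := by
  have h := abs_sub_round u
  rw [abs_le] at h
  obtain ⟨h1, h2⟩ := h
  have he : (u - ((round u : ℤ) : ℝ)) ^ 2 ≤ 1 / 4 := by nlinarith
  constructor
  · nlinarith [sq_nonneg (u + 2 * (u - ((round u : ℤ) : ℝ)))]
  · nlinarith [sq_nonneg (((round u : ℤ) : ℝ) - 2 * (u - ((round u : ℤ) : ℝ)))]

/-- **Rounding a step.** `(round v - round u)² ≤ 2(v - u)² + 2`, since the two rounding errors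
differ by at most `1`. [folklore] -/
theorem annulusChain_round_sub_round_sq_le (u v : ℝ) :
    (((round v : ℤ) : ℝ) - ((round u : ℤ) : ℝ)) ^ 2 ≤ 2 * (v - u) ^ 2 + 2 := by
  have hu := abs_sub_round u
  have hv := abs_sub_round v
  rw [abs_le] at hu hv
  obtain ⟨hu1, hu2⟩ := hu
  obtain ⟨hv1, hv2⟩ := hv
  have hf : ((v - ((round v : ℤ) : ℝ)) - (u - ((round u : ℤ) : ℝ))) ^ 2 ≤ 1 := by nlinarith
  nlinarith [sq_nonneg ((v - u) + ((v - ((round v : ℤ) : ℝ)) - (u - ((round u : ℤ) : ℝ))))]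

/-- **A segment between two shell points with non-negative inner product stays in the annulus.**
For `p, q ∈ ℝ³` with `|p|², |q|² ∈ [r²/4, r²]`, `⟨p,q⟩ ≥ 0` and `t ∈ [0,1]`:
`r²/8 ≤ |(1-t)p + tq|² ≤ r²` (expand; `(1-t)² + t² ≥ 1/2`; convexity for the upper bound).
[folklore] -/
theorem annulusChain_segment_sq_bounds (p q : Fin 3 → ℝ) (r t : ℝ) (ht0 : 0 ≤ t) (ht1 : t ≤ 1)
    (hp1 : r ^ 2 / 4 ≤ ∑ i, p i ^ 2) (hp2 : ∑ i, p i ^ 2 ≤ r ^ 2)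
    (hq1 : r ^ 2 / 4 ≤ ∑ i, q i ^ 2) (hq2 : ∑ i, q i ^ 2 ≤ r ^ 2)
    (hpq : 0 ≤ ∑ i, p i * q i) :
    r ^ 2 / 8 ≤ ∑ i, ((1 - t) * p i + t * q i) ^ 2 ∧
      ∑ i, ((1 - t) * p i + t * q i) ^ 2 ≤ r ^ 2 := by
  have hP : 2 * ∑ i, p i * q i ≤ ∑ i, p i ^ 2 + ∑ i, q i ^ 2 := by
    simp only [Fin.sum_univ_three]
    nlinarith [sq_nonneg (p 0 - q 0), sq_nonneg (p 1 - q 1), sq_nonneg (p 2 - q 2)]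
  have key : ∑ i, ((1 - t) * p i + t * q i) ^ 2 =
      (1 - t) ^ 2 * ∑ i, p i ^ 2 + t ^ 2 * ∑ i, q i ^ 2 + 2 * (t * (1 - t)) * ∑ i, p i * q i := by
    simp only [Fin.sum_univ_three]
    ring
  rw [key]
  have h1t : 0 ≤ 1 - t := sub_nonneg.2 ht1
  have htt : 0 ≤ t * (1 - t) := mul_nonneg ht0 h1t
  constructor
  · have h1 : (1 - t) ^ 2 * (r ^ 2 / 4) ≤ (1 - t) ^ 2 * ∑ i, p i ^ 2 :=
      mul_le_mul_of_nonneg_left hp1 (sq_nonneg _)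
    have h2 : t ^ 2 * (r ^ 2 / 4) ≤ t ^ 2 * ∑ i, q i ^ 2 :=
      mul_le_mul_of_nonneg_left hq1 (sq_nonneg _)
    have h3 : 0 ≤ 2 * (t * (1 - t)) * ∑ i, p i * q i := by positivity
    have h4 : r ^ 2 / 8 ≤ ((1 - t) ^ 2 + t ^ 2) * (r ^ 2 / 4) := by
      nlinarith [mul_nonneg (sq_nonneg (2 * t - 1)) (sq_nonneg r)]
    nlinarith
  · have h5 : 2 * (t * (1 - t)) * ∑ i, p i * q i ≤ (t * (1 - t)) * (∑ i, p i ^ 2 + ∑ i, q i ^ 2) := by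
      nlinarith [mul_le_mul_of_nonneg_left hP htt]
    have h6 : (1 - t) * ∑ i, p i ^ 2 ≤ (1 - t) * r ^ 2 := mul_le_mul_of_nonneg_left hp2 h1t
    have h7 : t * ∑ i, q i ^ 2 ≤ t * r ^ 2 := mul_le_mul_of_nonneg_left hq2 ht0
    nlinarith

/-- **Rounded segment points lie in the fat annulus.** Under the hypotheses of
`annulusChain_segment_sq_bounds` and `r ≥ 9`, the coordinatewise rounding `w` of `(1-t)p + tq`
satisfies `r/4 ≤ |w|₂ ≤ 2r` (`|w|₂² ∈ [(2/3)(r²/8) - 3/2, (3/2)r² + 9/4] ⊆ [r²/16, 4r²]`).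
[folklore] -/
theorem annulusChain_round_segment_mem (p q : Fin 3 → ℝ) (r t : ℝ) (hr : 9 ≤ r) (ht0 : 0 ≤ t)
    (ht1 : t ≤ 1) (hp1 : r ^ 2 / 4 ≤ ∑ i, p i ^ 2) (hp2 : ∑ i, p i ^ 2 ≤ r ^ 2)
    (hq1 : r ^ 2 / 4 ≤ ∑ i, q i ^ 2) (hq2 : ∑ i, q i ^ 2 ≤ r ^ 2) (hpq : 0 ≤ ∑ i, p i * q i) :
    r / 4 ≤ Real.sqrt (∑ i, ((round ((1 - t) * p i + t * q i) : ℤ) : ℝ) ^ 2) ∧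
      Real.sqrt (∑ i, ((round ((1 - t) * p i + t * q i) : ℤ) : ℝ) ^ 2) ≤ 2 * r := by
  obtain ⟨hlo, hhi⟩ := annulusChain_segment_sq_bounds p q r t ht0 ht1 hp1 hp2 hq1 hq2 hpq
  have e0 := annulusChain_round_sq_bounds ((1 - t) * p 0 + t * q 0)
  have e1 := annulusChain_round_sq_bounds ((1 - t) * p 1 + t * q 1)
  have e2 := annulusChain_round_sq_bounds ((1 - t) * p 2 + t * q 2)
  have hr2 : 81 ≤ r ^ 2 := by nlinarith
  simp only [Fin.sum_univ_three] at hlo hhi ⊢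
  constructor
  · apply Real.le_sqrt_of_sq_le
    nlinarith
  · rw [Real.sqrt_le_left (by linarith)]
    nlinarith

/-- **Consecutive rounded segment points are `θ r`-close.** If `|p|², |q|² ≤ r²`, `0 ≤ s`,
`4s ≤ θ` and `4/θ ≤ r`, the roundings of `(1-t)p + tq` and `(1-(t+s))p + (t+s)q` are at Euclidean
distance `≤ θ r` (`≤ √(2s²|q-p|² + 6) ≤ √(8s²r² + 6)`). [folklore] -/
theorem annulusChain_round_segment_step (p q : Fin 3 → ℝ) (r θ t s : ℝ) (hθ : 0 < θ)
    (hr : 4 / θ ≤ r) (hs0 : 0 ≤ s) (hs : 4 * s ≤ θ)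
    (hp2 : ∑ i, p i ^ 2 ≤ r ^ 2) (hq2 : ∑ i, q i ^ 2 ≤ r ^ 2) :
    Real.sqrt (∑ i, (((round ((1 - (t + s)) * p i + (t + s) * q i) : ℤ) : ℝ) -
      ((round ((1 - t) * p i + t * q i) : ℤ) : ℝ)) ^ 2) ≤ θ * r := by
  have d0 := annulusChain_round_sub_round_sq_le ((1 - t) * p 0 + t * q 0)
    ((1 - (t + s)) * p 0 + (t + s) * q 0)
  have d1 := annulusChain_round_sub_round_sq_le ((1 - t) * p 1 + t * q 1)
    ((1 - (t + s)) * p 1 + (t + s) * q 1)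
  have d2 := annulusChain_round_sub_round_sq_le ((1 - t) * p 2 + t * q 2)
    ((1 - (t + s)) * p 2 + (t + s) * q 2)
  rw [show (1 - (t + s)) * p 0 + (t + s) * q 0 - ((1 - t) * p 0 + t * q 0) = s * (q 0 - p 0) by ring]
    at d0
  rw [show (1 - (t + s)) * p 1 + (t + s) * q 1 - ((1 - t) * p 1 + t * q 1) = s * (q 1 - p 1) by ring]
    at d1
  rw [show (1 - (t + s)) * p 2 + (t + s) * q 2 - ((1 - t) * p 2 + t * q 2) = s * (q 2 - p 2) by ring]
    at d2
  have hθr : 4 ≤ θ * r := by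
    have h := (div_le_iff₀ hθ).1 hr
    linarith
  have hθr0 : 0 ≤ θ * r := by linarith
  have hθr2 : 16 ≤ (θ * r) ^ 2 := by nlinarith
  have h16 : 16 * s ^ 2 ≤ θ ^ 2 := by nlinarith
  rw [Real.sqrt_le_left hθr0]
  simp only [Fin.sum_univ_three] at hp2 hq2 ⊢
  have hpq : (q 0 - p 0) ^ 2 + (q 1 - p 1) ^ 2 + (q 2 - p 2) ^ 2 ≤ 4 * r ^ 2 := by
    nlinarith [sq_nonneg (q 0 + p 0), sq_nonneg (q 1 + p 1), sq_nonneg (q 2 + p 2)]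
  nlinarith [mul_le_mul_of_nonneg_left hpq (sq_nonneg s),
    mul_le_mul_of_nonneg_right h16 (sq_nonneg r)]

/-- **One segment, discretised.** For lattice points `p, q` of the shell `{r/2 ≤ |·|₂ ≤ r}` with
`⟨p,q⟩ ≥ 0`, `K ≥ 4/θ` (`K ≥ 1`), `r ≥ 9` and `r ≥ 4/θ`, the lattice points
`z j = round((1 - j/K)p + (j/K)q)` (coordinatewise), `j = 0,…,K`, form a chain from `p` to `q`
inside `{r/4 ≤ |·|₂ ≤ 2r}` with steps `≤ θ r`. [folklore] -/
theorem annulusChain_segment (θ r : ℝ) (K : ℕ) (hθ : 0 < θ) (hK : 0 < K) (hKθ : 4 / θ ≤ K)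
    (hr9 : 9 ≤ r) (hrθ : 4 / θ ≤ r) (p q : Site 3)
    (hp1 : r / 2 ≤ Real.sqrt (∑ i, ((p i : ℝ)) ^ 2)) (hp2 : Real.sqrt (∑ i, ((p i : ℝ)) ^ 2) ≤ r)
    (hq1 : r / 2 ≤ Real.sqrt (∑ i, ((q i : ℝ)) ^ 2)) (hq2 : Real.sqrt (∑ i, ((q i : ℝ)) ^ 2) ≤ r)
    (hpq : 0 ≤ ∑ i, (p i : ℝ) * (q i : ℝ)) :
    ∃ z : ℕ → Site 3, z 0 = p ∧ z K = q ∧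
      (∀ j : ℕ, j ≤ K → r / 4 ≤ Real.sqrt (∑ i, (((z j) i : ℝ)) ^ 2) ∧
        Real.sqrt (∑ i, (((z j) i : ℝ)) ^ 2) ≤ 2 * r) ∧
      (∀ j : ℕ, j < K →
        Real.sqrt (∑ i, (((z (j + 1)) i : ℝ) - ((z j) i : ℝ)) ^ 2) ≤ θ * r) := by
  have hr0 : 0 < r := by linarith
  have hp1' : r ^ 2 / 4 ≤ ∑ i, ((p i : ℝ)) ^ 2 := by
    have h := (Real.le_sqrt' (by positivity)).1 hp1
    nlinarith [h]
  have hp2' : ∑ i, ((p i : ℝ)) ^ 2 ≤ r ^ 2 := (Real.sqrt_le_left hr0.le).1 hp2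
  have hq1' : r ^ 2 / 4 ≤ ∑ i, ((q i : ℝ)) ^ 2 := by
    have h := (Real.le_sqrt' (by positivity)).1 hq1
    nlinarith [h]
  have hq2' : ∑ i, ((q i : ℝ)) ^ 2 ≤ r ^ 2 := (Real.sqrt_le_left hr0.le).1 hq2
  have hKr : (0 : ℝ) < K := Nat.cast_pos.2 hK
  refine ⟨fun j i => round ((1 - (j : ℝ) / K) * (p i : ℝ) + ((j : ℝ) / K) * (q i : ℝ)),
    ?_, ?_, ?_, ?_⟩
  · funext i
    simp [round_intCast]
  · funext i
    simp [div_self hKr.ne', round_intCast]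
  · intro j hj
    have ht0 : (0 : ℝ) ≤ (j : ℝ) / K := by positivity
    have ht1 : (j : ℝ) / K ≤ 1 := by
      rw [div_le_one hKr]
      exact_mod_cast hj
    exact annulusChain_round_segment_mem (fun i => (p i : ℝ)) (fun i => (q i : ℝ)) r ((j : ℝ) / K)
      hr9 ht0 ht1 hp1' hp2' hq1' hq2' hpq
  · intro j _hj
    have hs : ((j + 1 : ℕ) : ℝ) / K = (j : ℝ) / K + 1 / K := by
      push_cast
      ring
    have h4 : 4 * (1 / (K : ℝ)) ≤ θ := by
      have h := (div_le_iff₀ hθ).1 hKθ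
      rw [mul_one_div, div_le_iff₀ hKr]
      linarith
    have key := annulusChain_round_segment_step (fun i => (p i : ℝ)) (fun i => (q i : ℝ)) r θ
      ((j : ℝ) / K) (1 / K) hθ hrθ (by positivity) h4 hp2' hq2'
    dsimp only
    rw [hs]
    exact key

/-- **Axis point for the first segment.** For `r ≥ 2` and a lattice point `x`, the lattice point
`a = (±⌈r/2⌉, 0, 0)` (sign of `x₀`) lies in the shell `{r/2 ≤ |·|₂ ≤ r}` and has `⟨x,a⟩ ≥ 0`.
[folklore] -/
theorem annulusChain_axis_point_fst (r : ℝ) (hr : 2 ≤ r) (x : Site 3) :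
    ∃ a : Site 3, a 1 = 0 ∧ a 2 = 0 ∧ r / 2 ≤ Real.sqrt (∑ i, ((a i : ℝ)) ^ 2) ∧
      Real.sqrt (∑ i, ((a i : ℝ)) ^ 2) ≤ r ∧ 0 ≤ ∑ i, (x i : ℝ) * (a i : ℝ) := by
  have hc1 : r / 2 ≤ ((⌈r / 2⌉ : ℤ) : ℝ) := Int.le_ceil _
  have hc2 : ((⌈r / 2⌉ : ℤ) : ℝ) < r / 2 + 1 := Int.ceil_lt_add_one _
  have hc0 : 0 ≤ ((⌈r / 2⌉ : ℤ) : ℝ) := by linarith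
  obtain hx | hx := le_or_gt 0 (x 0)
  · have hx' : (0 : ℝ) ≤ (x 0 : ℝ) := by exact_mod_cast hx
    refine ⟨![⌈r / 2⌉, 0, 0], by simp, by simp, ?_, ?_, ?_⟩
    · rw [show ∑ i, (((![⌈r / 2⌉, 0, 0] : Site 3) i : ℤ) : ℝ) ^ 2 = ((⌈r / 2⌉ : ℤ) : ℝ) ^ 2 by
        simp [Fin.sum_univ_three], Real.sqrt_sq hc0]
      exact hc1
    · rw [show ∑ i, (((![⌈r / 2⌉, 0, 0] : Site 3) i : ℤ) : ℝ) ^ 2 = ((⌈r / 2⌉ : ℤ) : ℝ) ^ 2 by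
        simp [Fin.sum_univ_three], Real.sqrt_sq hc0]
      linarith
    · simp only [Fin.sum_univ_three]
      simp only [Matrix.cons_val_zero, Matrix.cons_val_one, Matrix.cons_val_two, Matrix.head_cons,
        Matrix.tail_cons, Int.cast_zero, mul_zero, add_zero]
      exact mul_nonneg hx' hc0
  · have hx' : (x 0 : ℝ) ≤ 0 := by exact_mod_cast hx.le
    refine ⟨![-⌈r / 2⌉, 0, 0], by simp, by simp, ?_, ?_, ?_⟩
    · rw [show ∑ i, (((![-⌈r / 2⌉, 0, 0] : Site 3) i : ℤ) : ℝ) ^ 2 = ((⌈r / 2⌉ : ℤ) : ℝ) ^ 2 by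
        simp [Fin.sum_univ_three], Real.sqrt_sq hc0]
      exact hc1
    · rw [show ∑ i, (((![-⌈r / 2⌉, 0, 0] : Site 3) i : ℤ) : ℝ) ^ 2 = ((⌈r / 2⌉ : ℤ) : ℝ) ^ 2 by
        simp [Fin.sum_univ_three], Real.sqrt_sq hc0]
      linarith
    · simp only [Fin.sum_univ_three]
      simp only [Matrix.cons_val_zero, Matrix.cons_val_one, Matrix.cons_val_two, Matrix.head_cons,
        Matrix.tail_cons, Int.cast_zero, Int.cast_neg, mul_zero, add_zero]
      nlinarith [mul_nonneg (neg_nonneg.2 hx') hc0]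

/-- **Axis point for the last segment.** For `r ≥ 2` and a lattice point `y`, the lattice point
`b = (0, ±⌈r/2⌉, 0)` (sign of `y₁`) lies in the shell `{r/2 ≤ |·|₂ ≤ r}` and has `⟨b,y⟩ ≥ 0`.
[folklore] -/
theorem annulusChain_axis_point_snd (r : ℝ) (hr : 2 ≤ r) (y : Site 3) :
    ∃ b : Site 3, b 0 = 0 ∧ b 2 = 0 ∧ r / 2 ≤ Real.sqrt (∑ i, ((b i : ℝ)) ^ 2) ∧
      Real.sqrt (∑ i, ((b i : ℝ)) ^ 2) ≤ r ∧ 0 ≤ ∑ i, (b i : ℝ) * (y i : ℝ) := by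
  have hc1 : r / 2 ≤ ((⌈r / 2⌉ : ℤ) : ℝ) := Int.le_ceil _
  have hc2 : ((⌈r / 2⌉ : ℤ) : ℝ) < r / 2 + 1 := Int.ceil_lt_add_one _
  have hc0 : 0 ≤ ((⌈r / 2⌉ : ℤ) : ℝ) := by linarith
  obtain hy | hy := le_or_gt 0 (y 1)
  · have hy' : (0 : ℝ) ≤ (y 1 : ℝ) := by exact_mod_cast hy
    refine ⟨![0, ⌈r / 2⌉, 0], by simp, by simp, ?_, ?_, ?_⟩
    · rw [show ∑ i, (((![0, ⌈r / 2⌉, 0] : Site 3) i : ℤ) : ℝ) ^ 2 = ((⌈r / 2⌉ : ℤ) : ℝ) ^ 2 by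
        simp [Fin.sum_univ_three], Real.sqrt_sq hc0]
      exact hc1
    · rw [show ∑ i, (((![0, ⌈r / 2⌉, 0] : Site 3) i : ℤ) : ℝ) ^ 2 = ((⌈r / 2⌉ : ℤ) : ℝ) ^ 2 by
        simp [Fin.sum_univ_three], Real.sqrt_sq hc0]
      linarith
    · simp only [Fin.sum_univ_three]
      simp only [Matrix.cons_val_zero, Matrix.cons_val_one, Matrix.cons_val_two, Matrix.head_cons,
        Matrix.tail_cons, Int.cast_zero, zero_mul, add_zero, zero_add]
      exact mul_nonneg hc0 hy'
  · have hy' : (y 1 : ℝ) ≤ 0 := by exact_mod_cast hy.le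
    refine ⟨![0, -⌈r / 2⌉, 0], by simp, by simp, ?_, ?_, ?_⟩
    · rw [show ∑ i, (((![0, -⌈r / 2⌉, 0] : Site 3) i : ℤ) : ℝ) ^ 2 = ((⌈r / 2⌉ : ℤ) : ℝ) ^ 2 by
        simp [Fin.sum_univ_three], Real.sqrt_sq hc0]
      exact hc1
    · rw [show ∑ i, (((![0, -⌈r / 2⌉, 0] : Site 3) i : ℤ) : ℝ) ^ 2 = ((⌈r / 2⌉ : ℤ) : ℝ) ^ 2 by
        simp [Fin.sum_univ_three], Real.sqrt_sq hc0]
      linarith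
    · simp only [Fin.sum_univ_three]
      simp only [Matrix.cons_val_zero, Matrix.cons_val_one, Matrix.cons_val_two, Matrix.head_cons,
        Matrix.tail_cons, Int.cast_zero, Int.cast_neg, zero_mul, add_zero, zero_add]
      nlinarith [mul_nonneg hc0 (neg_nonneg.2 hy')]

-- Implementation note for the registered docstring below: the chain actually built here uses three
-- segments `x → a → b → y` through the lattice axis points `a = (±⌈r/2⌉, 0, 0)`, `b = (0, ±⌈r/2⌉, 0)`
-- (so `⟨x,a⟩ ≥ 0`, `⟨a,b⟩ = 0`, `⟨b,y⟩ ≥ 0`), mesh `1/K` with `K = ⌈4/θ⌉₊`, `N = K + K + K`,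
-- `r₀ = 9 + 4/θ`; see the module docstring.
/-- **T4 (chains in a lattice annulus; pure geometry of `ℤ³ ⊂ ℝ³`).** For every step ratio `θ > 0`
there are `N` and `r₀` such that any two lattice points of the shell `{r/2 ≤ |x|₂ ≤ r}` (`r ≥ r₀`) are
joined by a chain of `N` lattice points inside the fat annulus `{r/4 ≤ |z|₂ ≤ 2r}` with consecutive
Euclidean steps `≤ θ r` (repetitions allowed). Proof: at most five straight segments through axis points
`(3r/4)(±eⱼ)` chosen with non-negative inner products (so `|(1-t)a + tb|² ≥ min(|a|²,|b|²)/2` along each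
segment), discretised at mesh `θr/2` and rounded to nearest lattice points (error `≤ √3/2`). The lead runs
the Harnack chain of T2 along it. Size M. -/
theorem stub_annulusChain :
    ∀ θ : ℝ, 0 < θ → ∃ (N : ℕ) (r₀ : ℝ), ∀ r : ℝ, r₀ ≤ r → ∀ x y : Literature.Probability.LatticeModels.Site 3, r / 2 ≤ Real.sqrt (∑ i, ((x i : ℝ)) ^ 2) → Real.sqrt (∑ i, ((x i : ℝ)) ^ 2) ≤ r → r / 2 ≤ Real.sqrt (∑ i, ((y i : ℝ)) ^ 2) → Real.sqrt (∑ i, ((y i : ℝ)) ^ 2) ≤ r → ∃ z : ℕ → Literature.Probability.LatticeModels.Site 3, z 0 = x ∧ z N = y ∧ (∀ j : ℕ, j ≤ N → r / 4 ≤ Real.sqrt (∑ i, (((z j) i : ℝ)) ^ 2) ∧ Real.sqrt (∑ i, (((z j) i : ℝ)) ^ 2) ≤ 2 * r) ∧ (∀ j : ℕ, j < N → Real.sqrt (∑ i, (((z (j + 1)) i : ℝ) - ((z j) i : ℝ)) ^ 2) ≤ θ * r) := by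
  intro θ hθ
  have hθ4 : 0 < 4 / θ := by positivity
  obtain ⟨K, hKθ, hK⟩ : ∃ K : ℕ, 4 / θ ≤ (K : ℝ) ∧ 0 < K :=
    ⟨⌈4 / θ⌉₊, Nat.le_ceil _, Nat.ceil_pos.2 hθ4⟩
  refine ⟨K + K + K, 9 + 4 / θ, ?_⟩
  intro r hr x y hx1 hx2 hy1 hy2
  have hr9 : 9 ≤ r := by linarith
  have hrθ : 4 / θ ≤ r := by linarith
  have hr2 : 2 ≤ r := by linarith
  obtain ⟨a, ha1, ha2, ha3, ha4, hxa⟩ := annulusChain_axis_point_fst r hr2 x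
  obtain ⟨b, hb0, hb2, hb3, hb4, hby⟩ := annulusChain_axis_point_snd r hr2 y
  have hab : 0 ≤ ∑ i, (a i : ℝ) * (b i : ℝ) := by
    simp [Fin.sum_univ_three, ha1, ha2, hb0]
  obtain ⟨z₁, h10, h1K, h1P, h1S⟩ :=
    annulusChain_segment θ r K hθ hK hKθ hr9 hrθ x a hx1 hx2 ha3 ha4 hxa
  obtain ⟨z₂, h20, h2K, h2P, h2S⟩ :=
    annulusChain_segment θ r K hθ hK hKθ hr9 hrθ a b ha3 ha4 hb3 hb4 hab
  obtain ⟨z₃, h30, h3K, h3P, h3S⟩ :=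
    annulusChain_segment θ r K hθ hK hKθ hr9 hrθ b y hb3 hb4 hy1 hy2 hby
  obtain ⟨z₁₂, h120, h12K, h12P, h12S⟩ := annulusChain_append
    (fun w : Site 3 => r / 4 ≤ Real.sqrt (∑ i, ((w i : ℝ)) ^ 2) ∧
      Real.sqrt (∑ i, ((w i : ℝ)) ^ 2) ≤ 2 * r)
    (fun w w' : Site 3 => Real.sqrt (∑ i, ((w' i : ℝ) - (w i : ℝ)) ^ 2) ≤ θ * r)
    z₁ z₂ K K (h1K.trans h20.symm) h1P h2P h1S h2S
  obtain ⟨z, hz0, hzN, hzP, hzS⟩ := annulusChain_append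
    (fun w : Site 3 => r / 4 ≤ Real.sqrt (∑ i, ((w i : ℝ)) ^ 2) ∧
      Real.sqrt (∑ i, ((w i : ℝ)) ^ 2) ≤ 2 * r)
    (fun w w' : Site 3 => Real.sqrt (∑ i, ((w' i : ℝ) - (w i : ℝ)) ^ 2) ≤ θ * r)
    z₁₂ z₃ (K + K) K (h12K.trans (h2K.trans h30.symm)) h12P h3P h12S h3S
  refine ⟨z, ?_, ?_, hzP, hzS⟩
  · rw [hz0, h120, h10]
  · rw [hzN, h3K]

end Summit.CriticalPhenomena.Ising3DConformalLimit.Theorems.PositiveSolutionAsymptotics
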